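import Summits.BirchSwinnertonDyer.BirchSwinnertonDyer.Theorems.ByReductionTypeAtTwoMultUpperHalfTowerCertAddv
import HarnessLib

/-!
# The good-ordinary TOWER gap doors (`KatoHalfPinch.towerGapAtTwo_of_layerSelmer_{numeric,nat,cert}`, tower-1 parts 7/8/9)
# with the FIFTH per-prime disjunct «ADDITIVE of odd c̄ ⟹ ZERO bits» (route ByReductionTypeAtTwo, crux `OrdKatoHalfAtTwo`,
# items stmt-BirchSwinnertonDyer-19271 / 19573 at the class; seat bsd-2adic-ord-2b GEN 0)

HONEST FRAMING (cell `bsd-2adic`, run/shared/lean/pub/bsd-2adic/, HUMAN RULINGS D-0036 / D-0054 / D-0074 row (A); planner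
GEN 20 RULING 2026-08-27T07:10:34Z): THEOREMS ONLY — no definition, no new named fact; nothing is booked; BSD is not proved
by any of this. PARTITION: X5@2 good-ordinary OPEN block (RESIDUAL-MAP B1·O1; 528 classes, 231 of which drop `Σ₃` under the
lever) × p = 2 — types-the-object-of (the per-prime local constant of the good-ordinary TOWER-gap certificate); closes none.

WHAT. Tower-1's doors `KatoHalfPinch.towerGapAtTwo_of_layerSelmer_numeric` (part 7, places), `…_nat` (part 8, rational
primes) and `…_cert` (part 9, every kernel-side datum decidable) price an odd ADDITIVE prime `ℓ` of `Δ_min` at the blanket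
`C_ℓ = 4` (two bits at each of the `2^{min(j', e_ℓ)}` places of the layer field). mult-2's `…MultTowerLocalAddv.lean` (p505183)
proves the kernel refinement: at an additive `v ∤ 2` whose Kodaira type has ODD geometric component group (types `II`, `IV`,
`IV*`, `II*`) the local tower kernel `𝒦_{v,n}[2^∞]` is TRIVIAL at every layer of every `ℤ₂`-extension, and the parity of `c̄`
is decided from `(ord_ℓ Δ_min, ord_ℓ c₄)` by the PARITY CERTIFICATE `ℓ ∣ c₄ ∧ ℓ^k ∥ Δ_min ∧ (k ∈ {2,4,5} ∨ (7 ≤ k ≠ 9 ∧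
ℓ^k ∣ c₄³))`; its `…MultUpperHalfTowerCertAddv.lean` (p505978) states the three doors with the constant at `2` a DATUM `C₂` and
the fifth disjunct. THIS FILE is the good-ordinary specialisation `C₂ = 4` (tower-1's `pTorsion_localTowerKer_at_two_le_four`:
PRINT `hS34` = Greenberg L.3.4@2 structure + `GoodOrd W 2`): the signatures below are parts 7/8/9 VERBATIM with ONE disjunct
added to `hC`, so a class file switches door by name and supplies the certificate at its odd-`c̄` additive primes; every
other binder, the sharp exponent and the arithmetic are unchanged. Doors in `Ш`-currency / on the `λ`-road as in part 9.

WHAT IS DISPLAYED, NOT PROVED: PRINT {`h33g`, `hM`, `hA`, `hS34`} (the first three are tree theorems `…_holds`);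
CERTIFICATES {`P`, `C`, `e`, `k`, `hlow`, `hup`, arithmetic}. ∀-LEVEL CONTENT: none.

References: R. Greenberg, LNM 1716 (1999), §3 Lemmas 3.3–3.5 (pp. 85–90), Prop. 2.5, Thm. 4.1, Prop. 4.14; K. Kato,
Astérisque 295 (2004), Thm. 17.4; J. H. Silverman, *AEC* VII.1, VII.5.1, VII.6.1; *ATAEC* IV.9 Table 4.1.
-/

set_option autoImplicit false
-- the Theorems namespace of this sub repeats the summit name by design (D-0017 nested layout: Summit.<S>.<Sub>)
set_option linter.dupNamespace false

noncomputable section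

open scoped Classical MatrixGroups ModularForm

open NumberField IsDedekindDomain CongruenceSubgroup WeierstrassCurve Literature.NumberTheory.EllipticCurves
  Literature.NumberTheory.EllipticCurves.ModularForms
  Literature.NumberTheory.EllipticCurves.Greenberg1999
  Literature.NumberTheory.EllipticCurves.Rank1Residual
  Literature.NumberTheory.EllipticCurves.Rank1Residual.Typed
  Literature.NumberTheory.GaloisRepresentations
  Summit.BirchSwinnertonDyer.Rank1Residual.X1.MuLambda
  Summit.BirchSwinnertonDyer.Rank1Residual.X1.MuPart
  Summit.BirchSwinnertonDyer.Rank1Residual.X1.ParitySqueeze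
  Summit.BirchSwinnertonDyer.BirchSwinnertonDyer.Theorems.Rank1ResidualX1Defs
  Summit.BirchSwinnertonDyer.Rank1Residual.X5 Summit.BirchSwinnertonDyer.Rank1Residual.X5.O1
  Summit.BirchSwinnertonDyer.Rank1Residual.X5.TowerGap
  Summit.BirchSwinnertonDyer.Rank1Residual
  Rat.HeightOneSpectrum

namespace Summit.BirchSwinnertonDyer.BirchSwinnertonDyer.Theorems.KatoHalfPinch

section Gap

variable (W : WeierstrassCurve ℚ) [W.IsElliptic] [W.IsGloballyMinimal]

/-- **The GAP certificate with NUMERIC local constants, FIVE disjuncts (good ordinary at `2`).** = part 7's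
`towerGapAtTwo_of_layerSelmer_numeric` with `hC` extended by `(additive ∧ 2 ∤ c̄_v ∧ 1 ≤ C_v)`; `C₂ = 4` from PRINT `hS34`.
[cite: GreenbergLNM1716, §3 Lemmas 3.3–3.5 (PDF pp. 86–90), Prop. 2.5] [cite: SilvermanATAEC1994, IV.9 Table 4.1] -/
theorem towerGapAtTwo_of_layerSelmer_numeric_addv
    (h33g : lemma33_localTowerKerPrimary_eq_bot_of_good.{0})
    (hM : lemma33_localTowerKerPrimary_cyclic_of_multiplicative.{0})
    (hA : lemma33_natCard_localTowerKerPrimary_le_four_of_additive.{0})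
    (hS34 : lemma34_localTowerKerPrimary_cyclicExtension_rat)
    (hgo : GoodOrd W 2) (htors : ¬ 2 ∣ W.torsionOrder) {j j' a d : ℕ} (hjj' : j ≤ j')
    (S : Finset (HeightOneSpectrum (𝓞 ℚ)))
    (hS : ∀ v ∉ S, ((2 : ℕ) : 𝓞 ℚ) ∉ v.asIdeal ∧ W.HasGoodReductionAt v)
    (C : HeightOneSpectrum (𝓞 ℚ) → ℕ)
    (hC : ∀ v ∈ S, ((2 : ℕ) : 𝓞 ℚ) ∉ v.asIdeal →
      4 ≤ C v ∨ (W.HasMultiplicativeReductionAt v ∧ 2 ≤ C v) ∨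
        (W.HasMultiplicativeReductionAt v ∧ ¬ 2 ∣ W.ordMinimalDiscriminant v ∧ 1 ≤ C v) ∨
        (W.HasGoodReductionAt v ∧ 1 ≤ C v) ∨
        (W.HasAdditiveReductionAt v ∧ ¬ 2 ∣ (W.kodairaSymbolAt v).componentGroupOrder ∧ 1 ≤ C v))
    (hlow : ∀ κ : ZpExtension ℚ 2, κ.IsCyclotomic →
      2 ^ a ≤ Nat.card {z : W.selmerLayer κ j // 2 • z = 0})
    (hup : ∀ κ : ZpExtension ℚ 2, κ.IsCyclotomic →
      Nat.card {z : W.selmerLayer κ j' // 2 • z = 0} ≤ 2 ^ d)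
    (harith : 2 ^ d * ∏ v ∈ S, (if ((2 : ℕ) : 𝓞 ℚ) ∈ v.asIdeal then 4 else C v) ^
        (if ((2 : ℕ) : 𝓞 ℚ) ∈ v.asIdeal then 1
          else 2 ^ min j' (padicValNat 2 (natGenerator v ^ 2 - 1) - 3)) <
      2 ^ (2 ^ j' - 2 ^ j + a)) : TowerGapAtTwo W :=
  MultTowerAddv.towerGapAtTwo_of_layerSelmer_numeric_atTwo_addv W h33g hM hA htors hjj' 4
    (fun κ hκ v h2v ↦ pTorsion_localTowerKer_at_two_le_four W hS34 hgo κ hκ v h2v j') S hS C hC hlow hup harith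

/-- **The GAP certificate indexed by rational primes, FIVE disjuncts (good ordinary at `2`).** = part 8's
`towerGapAtTwo_of_layerSelmer_nat` with the fifth disjunct: the PARITY CERTIFICATE `ℓ ∣ c₄(W_int)`, `ℓ^k ∥ Δ_min`,
`k ∈ {2,4,5} ∨ (7 ≤ k ≠ 9 ∧ ℓ^k ∣ c₄³)` (additive of type `II`/`IV`/`IV*`/`II*`) and `1 ≤ C ℓ`; arithmetic
`2^d · 4 · ∏_{ℓ ∈ P} C_ℓ^{2^{min(j', v₂(ℓ² − 1) − 3)}} < 2^{2^{j'} − 2^j + a}`.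
[cite: GreenbergLNM1716, §3 Lemmas 3.3–3.5 (PDF pp. 86–90), Prop. 2.5] [cite: SilvermanAEC2009, VII.1 Prop. 1.3, VII.5.1] -/
theorem towerGapAtTwo_of_layerSelmer_nat_addv
    (h33g : lemma33_localTowerKerPrimary_eq_bot_of_good.{0})
    (hM : lemma33_localTowerKerPrimary_cyclic_of_multiplicative.{0})
    (hA : lemma33_natCard_localTowerKerPrimary_le_four_of_additive.{0})
    (hS34 : lemma34_localTowerKerPrimary_cyclicExtension_rat)
    (hgo : GoodOrd W 2) (htors : ¬ 2 ∣ W.torsionOrder) {j j' a d : ℕ} (hjj' : j ≤ j')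
    (P : Finset ℕ) (hP : ∀ ℓ ∈ P, ℓ.Prime ∧ ℓ ≠ 2)
    (hΔ : ∀ ℓ : ℕ, ℓ.Prime → ℓ ≠ 2 → (ℓ : ℤ) ∣ W.minimalDiscriminantInt → ℓ ∈ P)
    (C : ℕ → ℕ)
    (hC : ∀ (ℓ : ℕ) [Fact ℓ.Prime], ℓ ∈ P →
      4 ≤ C ℓ ∨ (W.HasMultiplicativeReductionAtPrime ℓ ∧ 2 ≤ C ℓ) ∨
        (W.HasMultiplicativeReductionAtPrime ℓ ∧ ¬ 2 ∣ padicValInt ℓ W.minimalDiscriminantInt ∧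
          1 ≤ C ℓ) ∨
        (¬ (ℓ : ℤ) ∣ W.minimalDiscriminantInt ∧ 1 ≤ C ℓ) ∨
        ((∃ k : ℕ, (ℓ : ℤ) ∣ (integralModelInt W).c₄ ∧ (ℓ : ℤ) ^ k ∣ W.minimalDiscriminantInt ∧
            ¬ (ℓ : ℤ) ^ (k + 1) ∣ W.minimalDiscriminantInt ∧
            (k = 2 ∨ k = 4 ∨ k = 5 ∨ (7 ≤ k ∧ k ≠ 9 ∧ (ℓ : ℤ) ^ k ∣ (integralModelInt W).c₄ ^ 3))) ∧ 1 ≤ C ℓ))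
    (hlow : ∀ κ : ZpExtension ℚ 2, κ.IsCyclotomic →
      2 ^ a ≤ Nat.card {z : W.selmerLayer κ j // 2 • z = 0})
    (hup : ∀ κ : ZpExtension ℚ 2, κ.IsCyclotomic →
      Nat.card {z : W.selmerLayer κ j' // 2 • z = 0} ≤ 2 ^ d)
    (harith : 2 ^ d * 4 * ∏ ℓ ∈ P, C ℓ ^ 2 ^ min j' (padicValNat 2 (ℓ ^ 2 - 1) - 3) <
      2 ^ (2 ^ j' - 2 ^ j + a)) : TowerGapAtTwo W :=
  MultTowerAddv.towerGapAtTwo_of_layerSelmer_nat_atTwo_addv W h33g hM hA htors hjj' 4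
    (fun κ hκ v h2v ↦ pTorsion_localTowerKer_at_two_le_four W hS34 hgo κ hκ v h2v j') P hP hΔ C hC hlow hup harith

/-- **The GAP certificate, every kernel-side datum decidable, FIVE disjuncts (good ordinary at `2`).** = part 9's
`towerGapAtTwo_of_layerSelmer_cert` with the fifth disjunct `ℓ ∣ c₄(W_int) ∧ ℓ^{k_ℓ} ∥ Δ_min ∧ (k_ℓ ∈ {2,4,5} ∨ (7 ≤ k_ℓ ∧
k_ℓ ≠ 9 ∧ ℓ^{k_ℓ} ∣ c₄³)) ∧ 1 ≤ C_ℓ` (additive of type `II`/`IV`/`IV*`/`II*`: ZERO bits); arithmetic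
`2^d · 4 · ∏_{ℓ ∈ P} C_ℓ^{2^{min(j', e_ℓ)}} < 2^{2^{j'} − 2^j + a}`.
[cite: GreenbergLNM1716, §3 Lemmas 3.3–3.5 (PDF pp. 86–90), Prop. 2.5] [cite: SilvermanATAEC1994, IV.9 Table 4.1] -/
theorem towerGapAtTwo_of_layerSelmer_cert_addv
    (h33g : lemma33_localTowerKerPrimary_eq_bot_of_good.{0})
    (hM : lemma33_localTowerKerPrimary_cyclic_of_multiplicative.{0})
    (hA : lemma33_natCard_localTowerKerPrimary_le_four_of_additive.{0})
    (hS34 : lemma34_localTowerKerPrimary_cyclicExtension_rat)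
    (hgo : GoodOrd W 2) (htors : ¬ 2 ∣ W.torsionOrder) {j j' a d : ℕ} (hjj' : j ≤ j')
    (P : Finset ℕ) (hP : ∀ ℓ ∈ P, ℓ.Prime ∧ ℓ ≠ 2)
    (hΔ : ∀ ℓ : ℕ, ℓ.Prime → ℓ ≠ 2 → (ℓ : ℤ) ∣ W.minimalDiscriminantInt → ℓ ∈ P)
    (C e k : ℕ → ℕ) (he : ∀ ℓ ∈ P, ¬ 2 ^ (e ℓ + 4) ∣ ℓ ^ 2 - 1)
    (hC : ∀ (ℓ : ℕ) [Fact ℓ.Prime], ℓ ∈ P →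
      4 ≤ C ℓ ∨ (W.HasMultiplicativeReductionAtPrime ℓ ∧ 2 ≤ C ℓ) ∨
        (W.HasMultiplicativeReductionAtPrime ℓ ∧ (ℓ : ℤ) ^ k ℓ ∣ W.minimalDiscriminantInt ∧
          ¬ (ℓ : ℤ) ^ (k ℓ + 1) ∣ W.minimalDiscriminantInt ∧ ¬ 2 ∣ k ℓ ∧ 1 ≤ C ℓ) ∨
        (¬ (ℓ : ℤ) ∣ W.minimalDiscriminantInt ∧ 1 ≤ C ℓ) ∨
        ((ℓ : ℤ) ∣ (integralModelInt W).c₄ ∧ (ℓ : ℤ) ^ k ℓ ∣ W.minimalDiscriminantInt ∧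
          ¬ (ℓ : ℤ) ^ (k ℓ + 1) ∣ W.minimalDiscriminantInt ∧
          (k ℓ = 2 ∨ k ℓ = 4 ∨ k ℓ = 5 ∨ (7 ≤ k ℓ ∧ k ℓ ≠ 9 ∧ (ℓ : ℤ) ^ k ℓ ∣ (integralModelInt W).c₄ ^ 3)) ∧ 1 ≤ C ℓ))
    (hlow : ∀ κ : ZpExtension ℚ 2, κ.IsCyclotomic →
      2 ^ a ≤ Nat.card {z : W.selmerLayer κ j // 2 • z = 0})
    (hup : ∀ κ : ZpExtension ℚ 2, κ.IsCyclotomic →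
      Nat.card {z : W.selmerLayer κ j' // 2 • z = 0} ≤ 2 ^ d)
    (harith : 2 ^ d * 4 * ∏ ℓ ∈ P, C ℓ ^ 2 ^ min j' (e ℓ) < 2 ^ (2 ^ j' - 2 ^ j + a)) :
    TowerGapAtTwo W :=
  MultTowerAddv.towerGapAtTwo_of_layerSelmer_cert_atTwo_addv W h33g hM hA htors hjj' 4
    (fun κ hκ v h2v ↦ pTorsion_localTowerKer_at_two_le_four W hS34 hgo κ hκ v h2v j') P hP hΔ C e k he hC hlow hup harith

end Gap

/-! ### Doors (decidable certificates, five disjuncts) — part 9's doors with the door of §Gap -/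

section Doors

variable (W : WeierstrassCurve ℚ) [W.IsElliptic] [W.IsGloballyMinimal]

/-- **Door (`Ш`-currency, decidable certificates, FIVE disjuncts) for `BSD(E,2)` at analytic rank `0`** on a
good-ordinary-at-`2` curve with odd torsion order = part 9's `bsdp_two_of_layerSelmer_cert_of_missingLowerBoundAt` with the
zero-bit additive disjunct. PRINT: `hmod`, `hGZK`, `h17`, `hEC`, `h33g`, `hM`, `hA`, `hS34`. CERTIFICATES: `hper₀`; `P`/`hP`/`hΔ`;
`C`, `e`, `k` with `he`, `hC`; `hlow`/`hup`; the closed arithmetic; `MissingLowerBoundAt W 2`.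
[cite: GreenbergLNM1716, Thm. 4.1 (p. 102), §3 Lemmas 3.3–3.5, Prop. 2.5] [cite: Kato2004Asterisque, Thm. 17.4 (1)(2) (p. 273)]
[cite: Miller2011LMS, Def. 1.1] -/
theorem bsdp_two_of_layerSelmer_cert_addv_of_missingLowerBoundAt
    (hmod : nonempty_modularParametrizationData) (hGZK : rank_eq_analyticRank_of_analyticRank_le_one)
    (h17 : ∀ [NeZero (W.conductorNorm ℤ)] (f : CuspForm (Gamma0 (W.conductorNorm ℤ)) 2),
      kato_divisibility_allPrimes W 2 (f := f))
    (hEC : TwoAdicEulerCharRankZero W 0)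
    (h33g : lemma33_localTowerKerPrimary_eq_bot_of_good.{0})
    (hM : lemma33_localTowerKerPrimary_cyclic_of_multiplicative.{0})
    (hA : lemma33_natCard_localTowerKerPrimary_le_four_of_additive.{0})
    (hS34 : lemma34_localTowerKerPrimary_cyclicExtension_rat)
    (hper₀ : ∀ [NeZero (W.conductorNorm ℤ)] (f : CuspForm (Gamma0 (W.conductorNorm ℤ)) 2),
      IsNewformOf W f → ∀ ϖ : ℚ, (ϖ : ℝ) * W.realPeriodRat = plusPeriod f → 0 ≤ padicValRat 2 ϖ)
    (hgo : GoodOrd W 2) (hr : W.analyticRank = 0) (htors : ¬ 2 ∣ W.torsionOrder) {j j' a d : ℕ}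
    (hjj' : j ≤ j') (P : Finset ℕ) (hP : ∀ ℓ ∈ P, ℓ.Prime ∧ ℓ ≠ 2)
    (hΔ : ∀ ℓ : ℕ, ℓ.Prime → ℓ ≠ 2 → (ℓ : ℤ) ∣ W.minimalDiscriminantInt → ℓ ∈ P)
    (C e k : ℕ → ℕ) (he : ∀ ℓ ∈ P, ¬ 2 ^ (e ℓ + 4) ∣ ℓ ^ 2 - 1)
    (hC : ∀ (ℓ : ℕ) [Fact ℓ.Prime], ℓ ∈ P →
      4 ≤ C ℓ ∨ (W.HasMultiplicativeReductionAtPrime ℓ ∧ 2 ≤ C ℓ) ∨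
        (W.HasMultiplicativeReductionAtPrime ℓ ∧ (ℓ : ℤ) ^ k ℓ ∣ W.minimalDiscriminantInt ∧
          ¬ (ℓ : ℤ) ^ (k ℓ + 1) ∣ W.minimalDiscriminantInt ∧ ¬ 2 ∣ k ℓ ∧ 1 ≤ C ℓ) ∨
        (¬ (ℓ : ℤ) ∣ W.minimalDiscriminantInt ∧ 1 ≤ C ℓ) ∨
        ((ℓ : ℤ) ∣ (integralModelInt W).c₄ ∧ (ℓ : ℤ) ^ k ℓ ∣ W.minimalDiscriminantInt ∧
          ¬ (ℓ : ℤ) ^ (k ℓ + 1) ∣ W.minimalDiscriminantInt ∧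
          (k ℓ = 2 ∨ k ℓ = 4 ∨ k ℓ = 5 ∨ (7 ≤ k ℓ ∧ k ℓ ≠ 9 ∧ (ℓ : ℤ) ^ k ℓ ∣ (integralModelInt W).c₄ ^ 3)) ∧ 1 ≤ C ℓ))
    (hlow : ∀ κ : ZpExtension ℚ 2, κ.IsCyclotomic →
      2 ^ a ≤ Nat.card {z : W.selmerLayer κ j // 2 • z = 0})
    (hup : ∀ κ : ZpExtension ℚ 2, κ.IsCyclotomic →
      Nat.card {z : W.selmerLayer κ j' // 2 • z = 0} ≤ 2 ^ d)
    (harith : 2 ^ d * 4 * ∏ ℓ ∈ P, C ℓ ^ 2 ^ min j' (e ℓ) < 2 ^ (2 ^ j' - 2 ^ j + a))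
    (hsha : MissingLowerBoundAt W 2) : BSDp W 2 :=
  EisensteinShaCurrency.bsdp_two_of_towerGap_of_missingLowerBoundAt W h17 hper₀ hEC hGZK hmod hgo hr
    (towerGapAtTwo_of_layerSelmer_cert_addv W h33g hM hA hS34 hgo htors hjj' P hP hΔ C e k he hC hlow hup
      harith) hsha

/-- **Door (`Ш`-currency, decidable certificates, FIVE disjuncts): `MazurMainConjecture W 2`** at a rank-`0`
good-ordinary `W` with odd torsion order = part 9's door with the zero-bit additive disjunct.
[cite: Kato2004Asterisque, Thm. 17.4 (1)(2) (p. 273)] [cite: GreenbergLNM1716, Thm. 4.1 (p. 102), §3 Lemmas 3.3–3.5, Prop. 2.5] -/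
theorem mazurMainConjecture_two_of_layerSelmer_cert_addv_of_missingLowerBoundAt
    (hmod : nonempty_modularParametrizationData) (hGZK : rank_eq_analyticRank_of_analyticRank_le_one)
    (h17 : ∀ [NeZero (W.conductorNorm ℤ)] (f : CuspForm (Gamma0 (W.conductorNorm ℤ)) 2),
      kato_divisibility_allPrimes W 2 (f := f))
    (hEC : TwoAdicEulerCharRankZero W 0)
    (h33g : lemma33_localTowerKerPrimary_eq_bot_of_good.{0})
    (hM : lemma33_localTowerKerPrimary_cyclic_of_multiplicative.{0})
    (hA : lemma33_natCard_localTowerKerPrimary_le_four_of_additive.{0})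
    (hS34 : lemma34_localTowerKerPrimary_cyclicExtension_rat)
    (hper₀ : ∀ [NeZero (W.conductorNorm ℤ)] (f : CuspForm (Gamma0 (W.conductorNorm ℤ)) 2),
      IsNewformOf W f → ∀ ϖ : ℚ, (ϖ : ℝ) * W.realPeriodRat = plusPeriod f → 0 ≤ padicValRat 2 ϖ)
    (hgo : GoodOrd W 2) (hr : W.analyticRank = 0) (htors : ¬ 2 ∣ W.torsionOrder) {j j' a d : ℕ}
    (hjj' : j ≤ j') (P : Finset ℕ) (hP : ∀ ℓ ∈ P, ℓ.Prime ∧ ℓ ≠ 2)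
    (hΔ : ∀ ℓ : ℕ, ℓ.Prime → ℓ ≠ 2 → (ℓ : ℤ) ∣ W.minimalDiscriminantInt → ℓ ∈ P)
    (C e k : ℕ → ℕ) (he : ∀ ℓ ∈ P, ¬ 2 ^ (e ℓ + 4) ∣ ℓ ^ 2 - 1)
    (hC : ∀ (ℓ : ℕ) [Fact ℓ.Prime], ℓ ∈ P →
      4 ≤ C ℓ ∨ (W.HasMultiplicativeReductionAtPrime ℓ ∧ 2 ≤ C ℓ) ∨
        (W.HasMultiplicativeReductionAtPrime ℓ ∧ (ℓ : ℤ) ^ k ℓ ∣ W.minimalDiscriminantInt ∧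
          ¬ (ℓ : ℤ) ^ (k ℓ + 1) ∣ W.minimalDiscriminantInt ∧ ¬ 2 ∣ k ℓ ∧ 1 ≤ C ℓ) ∨
        (¬ (ℓ : ℤ) ∣ W.minimalDiscriminantInt ∧ 1 ≤ C ℓ) ∨
        ((ℓ : ℤ) ∣ (integralModelInt W).c₄ ∧ (ℓ : ℤ) ^ k ℓ ∣ W.minimalDiscriminantInt ∧
          ¬ (ℓ : ℤ) ^ (k ℓ + 1) ∣ W.minimalDiscriminantInt ∧
          (k ℓ = 2 ∨ k ℓ = 4 ∨ k ℓ = 5 ∨ (7 ≤ k ℓ ∧ k ℓ ≠ 9 ∧ (ℓ : ℤ) ^ k ℓ ∣ (integralModelInt W).c₄ ^ 3)) ∧ 1 ≤ C ℓ))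
    (hlow : ∀ κ : ZpExtension ℚ 2, κ.IsCyclotomic →
      2 ^ a ≤ Nat.card {z : W.selmerLayer κ j // 2 • z = 0})
    (hup : ∀ κ : ZpExtension ℚ 2, κ.IsCyclotomic →
      Nat.card {z : W.selmerLayer κ j' // 2 • z = 0} ≤ 2 ^ d)
    (harith : 2 ^ d * 4 * ∏ ℓ ∈ P, C ℓ ^ 2 ^ min j' (e ℓ) < 2 ^ (2 ^ j' - 2 ^ j + a))
    (hsha : MissingLowerBoundAt W 2) : MazurMainConjecture W 2 :=
  EisensteinShaCurrency.mazurMainConjecture_two_of_towerGap_of_missingLowerBoundAt W h17 hper₀ hEC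
    hGZK hmod hgo hr
    (towerGapAtTwo_of_layerSelmer_cert_addv W h33g hM hA hS34 hgo htors hjj' P hP hΔ C e k he hC hlow hup
      harith) hsha

/-- **The Kato–Néron half (the item `OrdKatoHalfAtTwo` AT `W`), `λ`-road, decidable certificates, FIVE disjuncts**, any
analytic rank, odd torsion order = part 9's `katoHalfAt_two_of_layerSelmer_cert` with the zero-bit additive disjunct.
[cite: Kato2004Asterisque, Thm. 17.4 (1)(2) (p. 273)] [cite: GreenbergLNM1716, Prop. 4.14, §3 Lemmas 3.3–3.5, Prop. 2.5] -/
theorem katoHalfAt_two_of_layerSelmer_cert_addv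
    (h17 : ∀ [NeZero (W.conductorNorm ℤ)] (f : CuspForm (Gamma0 (W.conductorNorm ℤ)) 2),
      kato_divisibility_allPrimes W 2 (f := f))
    (h414 : prop414_noFiniteSubmodule_of_not_dvd_torsionOrder)
    (h33g : lemma33_localTowerKerPrimary_eq_bot_of_good.{0})
    (hM : lemma33_localTowerKerPrimary_cyclic_of_multiplicative.{0})
    (hA : lemma33_natCard_localTowerKerPrimary_le_four_of_additive.{0})
    (hS34 : lemma34_localTowerKerPrimary_cyclicExtension_rat)
    (hper₀ : ∀ [NeZero (W.conductorNorm ℤ)] (f : CuspForm (Gamma0 (W.conductorNorm ℤ)) 2),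
      IsNewformOf W f → ∀ ϖ : ℚ, (ϖ : ℝ) * W.realPeriodRat = plusPeriod f → 0 ≤ padicValRat 2 ϖ)
    (hgo : GoodOrd W 2) (htors : ¬ 2 ∣ W.torsionOrder) {n j₀ j j' a d : ℕ}
    (hrank : ∀ κ : ZpExtension ℚ 2, κ.IsCyclotomic →
      2 ^ n ≤ Nat.card {z : W.selmerLayer κ j₀ // 2 • z = 0})
    (hjj' : j ≤ j') (P : Finset ℕ) (hP : ∀ ℓ ∈ P, ℓ.Prime ∧ ℓ ≠ 2)
    (hΔ : ∀ ℓ : ℕ, ℓ.Prime → ℓ ≠ 2 → (ℓ : ℤ) ∣ W.minimalDiscriminantInt → ℓ ∈ P)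
    (C e k : ℕ → ℕ) (he : ∀ ℓ ∈ P, ¬ 2 ^ (e ℓ + 4) ∣ ℓ ^ 2 - 1)
    (hC : ∀ (ℓ : ℕ) [Fact ℓ.Prime], ℓ ∈ P →
      4 ≤ C ℓ ∨ (W.HasMultiplicativeReductionAtPrime ℓ ∧ 2 ≤ C ℓ) ∨
        (W.HasMultiplicativeReductionAtPrime ℓ ∧ (ℓ : ℤ) ^ k ℓ ∣ W.minimalDiscriminantInt ∧
          ¬ (ℓ : ℤ) ^ (k ℓ + 1) ∣ W.minimalDiscriminantInt ∧ ¬ 2 ∣ k ℓ ∧ 1 ≤ C ℓ) ∨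
        (¬ (ℓ : ℤ) ∣ W.minimalDiscriminantInt ∧ 1 ≤ C ℓ) ∨
        ((ℓ : ℤ) ∣ (integralModelInt W).c₄ ∧ (ℓ : ℤ) ^ k ℓ ∣ W.minimalDiscriminantInt ∧
          ¬ (ℓ : ℤ) ^ (k ℓ + 1) ∣ W.minimalDiscriminantInt ∧
          (k ℓ = 2 ∨ k ℓ = 4 ∨ k ℓ = 5 ∨ (7 ≤ k ℓ ∧ k ℓ ≠ 9 ∧ (ℓ : ℤ) ^ k ℓ ∣ (integralModelInt W).c₄ ^ 3)) ∧ 1 ≤ C ℓ))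
    (hlow : ∀ κ : ZpExtension ℚ 2, κ.IsCyclotomic →
      2 ^ a ≤ Nat.card {z : W.selmerLayer κ j // 2 • z = 0})
    (hup : ∀ κ : ZpExtension ℚ 2, κ.IsCyclotomic →
      Nat.card {z : W.selmerLayer κ j' // 2 • z = 0} ≤ 2 ^ d)
    (harith : 2 ^ d * 4 * ∏ ℓ ∈ P, C ℓ ^ 2 ^ min j' (e ℓ) < 2 ^ (2 ^ j' - 2 ^ j + a))
    (hlan : AnalyticLambdaEq W 2 n) (hμan : AnalyticMuLE W 2 0) :
    MainConjectureLowerDivisibilityAtTwoOrd W :=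
  katoHalfAt_two_of_towerGap_of_layerSelmer W h17 h414 hper₀ hgo htors
    (towerGapAtTwo_of_layerSelmer_cert_addv W h33g hM hA hS34 hgo htors hjj' P hP hΔ C e k he hC hlow hup
      harith) hrank hlan hμan

end Doors

end Summit.BirchSwinnertonDyer.BirchSwinnertonDyer.Theorems.KatoHalfPinch

end
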